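import Mathlib
import HarnessLib
import Summits.HubbardSuperconductivity.HubbardSuperconductivity.Theorems.KLProgrammeC4aTadpoleRepresentation
import Literature.MathematicalPhysics.QuantumLattice.HubbardInteractionKernels

/-!
# Route `KLProgramme` — crux C4a, THE BARE TADPOLE VERTEX IS A CONSTANT: `tadpoleVertex β V p₀ ≡ −U/(β²L²)` for the Hubbard vertex `V` (and `V + 𝒩_K`)
# — the Hartree part of the one-line term, by the character-polynomial uniqueness (no position-space Fourier computation)

Cell `gate-hubbard-kl`, lane hubbard-kl-c4a-1 (g5); helper for stub (C) `stub_twoLeg_curvature` of the engine-flow child `KLRegimeEngineV17F2`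
(stmt-HubbardSuperconductivity-20437); memo HOME/hubbard-kl-c4a-1/C4A-PLAN.md §12.3′ (Hartree split), §17.2, §22.  The (A)-closer splits
`𝒱_n = V_K + (𝒱_n − V_K)` (`tadpoleVertex_add`); the first part must be a θ-BLIND, indeed CONSTANT, vertex so that `tubeTadpole_const_vertex` /
`norm_tubeTadpole_const_le` (`…C4aTubeTadpoleValue`) apply and the reference-subtracted assembly (`…C4aTadpoleJetAssemblyRef`) may take `V★ := const`:

* §1 **`kernel_hubbardInteraction_tadpoleLegs`** — at the tadpole legs `(K,σ,+),(K,σ,−),(p,τ,−),(p,τ,+)` the quartic kernel of the Hubbard vertex is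
  `[σ ≠ τ]·(−1)·U(βL²)⁻³·(4!)⁻¹` (conservation `K − K + p − p = 0` is automatic; equal spins see no vertex; the leg string is an ODD reordering of
  `vertexLegs`, `kernel_hubbardInteraction_vertexLegs_comp_perm`);
* §2 **`tadpoleVertex_hubbardInteraction_lattice`** — at lattice momenta `tadpoleVertex β V p₀ (p_k⃗) (p_q⃗) = 6βL⁴·Σ_{σ,τ,±} kernel = −U/(β²L²)`
  (`kernel_four_loop_eq_sum_torusChar` backwards through `loopCoeff_latticeMomentum`);
* §3 **`tadpoleVertex_hubbardInteraction`** — hence at EVERY pair of continuum momenta (two applications of `IsCharPoly.eq_of_eq_latticeMomentum`: the vertex is a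
  canonical character polynomial in each slot), and `tadpoleVertex_hubbardInteractionCT` (the countertermed vertex has the same quartic kernel).

Exact identities; nothing is asserted about the Hubbard model's sizes; nothing asserts superconductivity.
References: BGM 2006 §2.1 (2.6a), §2.3 (2.17) [cite: BenfattoGiulianiMastropietro2006]; Salmhofer 1998 §5.1 (the Hartree tadpole) [cite: Salmhofer1998].
-/

noncomputable section

namespace Summit.HubbardSuperconductivity.HubbardSuperconductivity.Theorems.C4a

set_option linter.dupNamespace false -- summit = problem name (single-conjunct summit), D-0017

open Real Finset Literature.MathematicalPhysics.QuantumLattice Literature.Probability.LatticeModels GrassmannAlgebra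
open Summit.HubbardSuperconductivity.HubbardSuperconductivity.Theorems.KLRegimeSplit

variable {L M : ℕ} [NeZero L] [NeZero M]

/-! ## §1 The quartic kernel of the Hubbard vertex at the tadpole legs -/

omit [NeZero M] in
/-- Equal spins: the tadpole leg string is not a reordering of any `vertexLegs κ` (two columns of the delta matrix vanish), so the kernel is `0`. -/
theorem kernel_hubbardInteraction_tadpoleLegs_of_eq (β U : ℝ) (K p : FreqMomentum L M) (σ : Fin 2) :
    kernel ℂ (hubbardInteraction L M β U) 4 (fun i => ((![K, K, p, p] i, ![σ, σ, σ, σ] i), (![0, 1, 1, 0] : Fin 4 → Fin 2) i)) = 0 := by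
  rw [hubbardInteraction_eq_sum_smul, kernel_sum]
  refine Finset.sum_eq_zero fun κ _ => ?_
  rw [kernel_smul, vertexMonomial_eq_genProd, kernel_genProd]
  have hdet : (deltaMatrix ℂ (fun i => ((![K, K, p, p] i, ![σ, σ, σ, σ] i), (![0, 1, 1, 0] : Fin 4 → Fin 2) i)) (vertexLegs L M κ)).det = 0 := by
    fin_cases σ
    · refine Matrix.det_eq_zero_of_column_eq_zero 2 fun i => ?_
      fin_cases i <;> simp [vertexLegs]
    · refine Matrix.det_eq_zero_of_column_eq_zero 0 fun i => ?_
      fin_cases i <;> simp [vertexLegs]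
  rw [hdet, mul_zero, mul_zero]

omit [NeZero M] in
/-- **The quartic kernel of the Hubbard vertex at the tadpole legs** `(K,σ,+),(K,σ,−),(p,τ,−),(p,τ,+)`:
`[σ ≠ τ]·(−1)·U(βL²)⁻³·(4!)⁻¹` — independent of the momenta. [cite: BenfattoGiulianiMastropietro2006, §2.1 (2.6a)] -/
theorem kernel_hubbardInteraction_tadpoleLegs (β U : ℝ) (K p : FreqMomentum L M) (σ τ : Fin 2) :
    kernel ℂ (hubbardInteraction L M β U) 4 (fun i => ((![K, K, p, p] i, ![σ, σ, τ, τ] i), (![0, 1, 1, 0] : Fin 4 → Fin 2) i)) =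
      if σ = τ then 0 else -((((U / (β * (L : ℝ) ^ 2) ^ 3 : ℝ)) : ℂ) * ((((4 : ℕ).factorial : ℚ)⁻¹ • (1 : ℂ)))) := by
  by_cases hστ : σ = τ
  · subst hστ
    rw [if_pos rfl]
    exact kernel_hubbardInteraction_tadpoleLegs_of_eq β U K p σ
  rw [if_neg hστ]
  have hσ : σ = 0 ∨ σ = 1 := by fin_cases σ <;> simp
  have hτ : τ = 0 ∨ τ = 1 := by fin_cases τ <;> simp
  rcases hσ with rfl | rfl <;> rcases hτ with rfl | rfl
  · exact absurd rfl hστ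
  · -- σ = ↑, τ = ↓ : the legs are `vertexLegs (K,K,p,p)` with slots 2, 3 swapped
    have hlegs : (fun i => ((![K, K, p, p] i, ![(0 : Fin 2), 0, 1, 1] i), (![0, 1, 1, 0] : Fin 4 → Fin 2) i)) =
        vertexLegs L M ![K, K, p, p] ∘ (Equiv.swap (2 : Fin 4) 3) := by
      funext i
      fin_cases i <;> simp [vertexLegs, Equiv.swap_apply_def]
    have hcons : vertexConserving L M ![K, K, p, p] := by simp [vertexConserving]
    rw [hlegs, kernel_hubbardInteraction_vertexLegs_comp_perm, if_pos hcons, Equiv.Perm.sign_swap (by decide)]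
    simp
  · -- σ = ↓, τ = ↑ : the legs are `vertexLegs (p,p,K,K)` reordered by the 4-cycle 0→2, 1→3, 2→1, 3→0
    have hlegs : (fun i => ((![K, K, p, p] i, ![(1 : Fin 2), 1, 0, 0] i), (![0, 1, 1, 0] : Fin 4 → Fin 2) i)) =
        vertexLegs L M ![p, p, K, K] ∘ (Equiv.swap (0 : Fin 4) 3 * Equiv.swap (0 : Fin 4) 1 * Equiv.swap (0 : Fin 4) 2) := by
      funext i
      fin_cases i <;> simp [vertexLegs, Equiv.swap_apply_def]
    have hcons : vertexConserving L M ![p, p, K, K] := by simp [vertexConserving]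
    have hsign : Equiv.Perm.sign (Equiv.swap (0 : Fin 4) 3 * Equiv.swap (0 : Fin 4) 1 * Equiv.swap (0 : Fin 4) 2) = -1 := by decide
    rw [hlegs, kernel_hubbardInteraction_vertexLegs_comp_perm, if_pos hcons, hsign]
    simp
  · exact absurd rfl hστ

/-! ## §2 The bare tadpole vertex at lattice momenta -/

/-- **At lattice momenta the bare tadpole vertex is `6βL⁴·Σ_{σ,τ,±} kernel = −U/(β²L²)`** (`β ≠ 0`). [cite: BenfattoGiulianiMastropietro2006, §2.3 (2.17)] -/
theorem tadpoleVertex_hubbardInteraction_lattice {β : ℝ} (hβ : β ≠ 0) (U : ℝ) (p₀ : MatsubaraIdx M) (k q : TorusSite 2 L) :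
    tadpoleVertex β (hubbardInteraction L M β U) p₀ (WithLp.toLp 2 (latticeMomentum L k)) (WithLp.toLp 2 (latticeMomentum L q)) =
      (((-(U / (β ^ 2 * (L : ℝ) ^ 2))) : ℝ) : ℂ) := by
  have hL : (L : ℂ) ≠ 0 := Nat.cast_ne_zero.2 (NeZero.ne L)
  have hβ' : (β : ℂ) ≠ 0 := Complex.ofReal_ne_zero.2 hβ
  -- the plane wave at a lattice loop momentum is the character
  have hpw : ∀ y : TorusSite 2 L, Complex.exp (((∑ i, ((y i).valMinAbs : ℝ) * (WithLp.toLp 2 (latticeMomentum L q) : Momentum) i : ℝ) : ℂ) *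
      Complex.I) = torusChar q y := by
    intro y
    rw [torusChar_eq_cexp_valMinAbs]
    congr 3
    exact Finset.sum_congr rfl fun i _ => by rw [PiLp.toLp_apply, mul_comm]
  -- the loop sum of the continuum loop coefficient at a lattice external momentum is the momentum kernel
  have hloop : ∀ (κ' : MatsubaraIdx M) (σ τ : Fin 2),
      ∑ y : TorusSite 2 L, loopCoeffCont β (hubbardInteraction L M β U) κ' p₀ σ τ (latticeMomentum L k) y * torusChar q y =
        kernel ℂ (hubbardInteraction L M β U) 4
          (fun i => ((![(κ', k), (κ', k), (p₀, q), (p₀, q)] i, ![σ, σ, τ, τ] i), (![0, 1, 1, 0] : Fin 4 → Fin 2) i)) := by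
    intro κ' σ τ
    rw [kernel_four_loop_eq_sum_torusChar hβ]
    exact Finset.sum_congr rfl fun y _ => by rw [← loopCoeff_latticeMomentum]
  rw [tadpoleVertex_apply_toLp]
  simp_rw [hpw]
  -- pull the prefactor and regroup the sums
  have step1 : ∑ y : TorusSite 2 L, tadpoleCoeff β (hubbardInteraction L M β U) p₀ (latticeMomentum L k) y * torusChar q y =
      ((6 * β * (L : ℝ) ^ 4 : ℝ) : ℂ) * ∑ σ : Fin 2, ∑ τ : Fin 2, ∑ κ : Fin 2, ∑ y : TorusSite 2 L,
        loopCoeffCont β (hubbardInteraction L M β U) ((![omega0 M, (omega0 M).rev] : Fin 2 → MatsubaraIdx M) κ) p₀ σ τ (latticeMomentum L k) y *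
          torusChar q y := by
    unfold tadpoleCoeff
    simp_rw [mul_assoc, ← Finset.mul_sum, Finset.sum_mul]
    congr 1
    rw [Finset.sum_comm]
    refine Finset.sum_congr rfl fun σ _ => ?_
    rw [Finset.sum_comm]
    refine Finset.sum_congr rfl fun τ _ => ?_
    rw [Finset.sum_comm]
  rw [step1]
  simp_rw [hloop, kernel_hubbardInteraction_tadpoleLegs]
  simp only [Fin.sum_univ_two, Fin.isValue, if_true, zero_ne_one, one_ne_zero, if_false]
  norm_num [Nat.factorial]
  field_simp
  ring

/-! ## §3 The bare tadpole vertex is the constant `−U/(β²L²)` at every pair of continuum momenta -/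

/-- The vertex in its LOOP slot is a canonical character polynomial (frequencies `ỹ`, coefficients `𝒟_{p₀}(P, y)`). -/
theorem isCharPoly_tadpoleVertex_loop (β : ℝ) (W : HubbardGrassmann L M) (p₀ : MatsubaraIdx M) (Pm : Momentum) :
    IsCharPoly L fun Q : Fin 2 → ℝ => tadpoleVertex β W p₀ Pm (WithLp.toLp 2 Q) := by
  refine ⟨fun y => tadpoleCoeff β W p₀ (WithLp.ofLp Pm) y, fun Q => ?_⟩
  unfold tadpoleVertex
  refine Finset.sum_congr rfl fun y _ => ?_
  rw [show (∑ i, ((y i).valMinAbs : ℝ) * (WithLp.toLp 2 Q : Momentum) i) = ∑ j, Q j * ((y j).valMinAbs : ℝ) from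
    Finset.sum_congr rfl fun i _ => by rw [PiLp.toLp_apply, mul_comm]]

/-- The vertex in its EXTERNAL slot is a canonical character polynomial. -/
theorem isCharPoly_tadpoleVertex_ext (β : ℝ) (W : HubbardGrassmann L M) (p₀ : MatsubaraIdx M) (q : Momentum) :
    IsCharPoly L fun P : Fin 2 → ℝ => tadpoleVertex β W p₀ (WithLp.toLp 2 P) q := by
  simp_rw [tadpoleVertex_apply_toLp]
  exact IsCharPoly.sum _ fun y => (isCharPoly_tadpoleCoeff β W p₀ y).mul_const _

/-- **THE BARE TADPOLE VERTEX IS THE CONSTANT `−U/(β²L²)`** (`β ≠ 0`): for all continuum momenta `P, q`,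
`tadpoleVertex β (hubbardInteraction L M β U) p₀ P q = −U/(β²L²)` — the Hartree vertex is θ-blind and loop-blind (`tubeTadpole_const_vertex`).
[cite: Salmhofer1998, §5.1] -/
theorem tadpoleVertex_hubbardInteraction {β : ℝ} (hβ : β ≠ 0) (U : ℝ) (p₀ : MatsubaraIdx M) (Pm q : Momentum) :
    tadpoleVertex β (hubbardInteraction L M β U) p₀ Pm q = (((-(U / (β ^ 2 * (L : ℝ) ^ 2))) : ℝ) : ℂ) := by
  -- external slot at a lattice loop momentum
  have hext : ∀ (q' : TorusSite 2 L) (P : Fin 2 → ℝ),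
      tadpoleVertex β (hubbardInteraction L M β U) p₀ (WithLp.toLp 2 P) (WithLp.toLp 2 (latticeMomentum L q')) =
        (((-(U / (β ^ 2 * (L : ℝ) ^ 2))) : ℝ) : ℂ) := fun q' P =>
    (isCharPoly_tadpoleVertex_ext β _ p₀ _).eq_of_eq_latticeMomentum (isCharPoly_const _)
      (fun k => tadpoleVertex_hubbardInteraction_lattice hβ U p₀ k q') P
  -- loop slot
  have hloop : ∀ Q : Fin 2 → ℝ, tadpoleVertex β (hubbardInteraction L M β U) p₀ Pm (WithLp.toLp 2 Q) =
      (((-(U / (β ^ 2 * (L : ℝ) ^ 2))) : ℝ) : ℂ) := fun Q =>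
    (isCharPoly_tadpoleVertex_loop β _ p₀ Pm).eq_of_eq_latticeMomentum (isCharPoly_const _)
      (fun q' => by
        have h := hext q' (WithLp.ofLp Pm)
        rwa [WithLp.toLp_ofLp] at h) Q
  have h := hloop (WithLp.ofLp q)
  rwa [WithLp.toLp_ofLp] at h

omit [NeZero M] in
/-- Position-space kernels of degree `4` only read the quartic momentum kernel. -/
theorem positionKernel_four_congr (β : ℝ) {G G' : HubbardGrassmann L M} (h : ∀ X, kernel ℂ G 4 X = kernel ℂ G' 4 X)
    (ξ : Fin 4 → (SpaceTimeIdx L M × Fin 2) × Fin 2) : positionKernel L M β G 4 ξ = positionKernel L M β G' 4 ξ := by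
  simp only [positionKernel, h]

/-- **The countertermed vertex `V_K = V + 𝒩_K` has the same tadpole vertex** (its quartic kernel is the bare one, `kernel_hubbardInteractionCT_four`). -/
theorem tadpoleVertex_hubbardInteractionCT (β U : ℝ) (K : TrigPolyC4v) (p₀ : MatsubaraIdx M) :
    tadpoleVertex β (hubbardInteractionCT L M β U K) p₀ = tadpoleVertex β (hubbardInteraction L M β U) p₀ := by
  funext Pm q
  simp only [tadpoleVertex, tadpoleCoeff, loopCoeffCont, positionKernel_four_congr β (kernel_hubbardInteractionCT_four β U K)]

/-- **The Hartree vertex at the frame `K`**: `tadpoleVertex β (V + 𝒩_K) p₀ P q = −U/(β²L²)` for all `P, q` (`β ≠ 0`). [cite: Salmhofer1998, §5.1] -/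
theorem tadpoleVertex_hubbardInteractionCT_eq_const {β : ℝ} (hβ : β ≠ 0) (U : ℝ) (K : TrigPolyC4v) (p₀ : MatsubaraIdx M) (Pm q : Momentum) :
    tadpoleVertex β (hubbardInteractionCT L M β U K) p₀ Pm q = (((-(U / (β ^ 2 * (L : ℝ) ^ 2))) : ℝ) : ℂ) := by
  rw [tadpoleVertex_hubbardInteractionCT, tadpoleVertex_hubbardInteraction hβ]

/-! ## §4 (append, g5) The continuum tadpole as an EXACT lattice Riemann sum over the vertex; the Hartree one-line value in closed form -/

/-- The plane wave of the continuum vertex at a lattice loop momentum is the torus character. -/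
theorem cexp_valMinAbs_toLp_latticeMomentum (q y : TorusSite 2 L) :
    Complex.exp (((∑ i, ((y i).valMinAbs : ℝ) * (WithLp.toLp 2 (latticeMomentum L q) : Momentum) i : ℝ) : ℂ) * Complex.I) = torusChar q y := by
  rw [torusChar_eq_cexp_valMinAbs]
  congr 3
  exact Finset.sum_congr rfl fun i _ => by rw [PiLp.toLp_apply, mul_comm]

/-- **The continuum tadpole is an EXACT lattice Riemann sum over the continuum vertex**: for every `W` and every continuum external point `P`,
`tadpoleCont β μ K Λ Λ' W P = Σ_{p₀} L⁻²·Σ_q ŝ_{p₀}(e_K(p_q))·V_{p₀}(P, p_q)` (`p_q` the lattice momenta, `V = tadpoleVertex`). -/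
theorem tadpoleCont_eq_sum_sliceSymbol_mul_tadpoleVertex (β μ : ℝ) (K : TrigPolyC4v) (Λ Λ' : ℝ) (W : HubbardGrassmann L M) (P : Fin 2 → ℝ) :
    tadpoleCont β μ K Λ Λ' W P =
      ∑ p₀ : MatsubaraIdx M, ((L : ℂ) ^ 2)⁻¹ * ∑ q : TorusSite 2 L,
        sliceSymbolFnXi (β * (L : ℝ) ^ 2) 0 Λ Λ' (matsubaraFreq β M p₀) (DispersionFlow.frameLevel μ K (WithLp.toLp 2 (latticeMomentum L q))) *
          tadpoleVertex β W p₀ (WithLp.toLp 2 P) (WithLp.toLp 2 (latticeMomentum L q)) := by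
  unfold tadpoleCont
  refine Finset.sum_congr rfl fun p₀ _ => ?_
  simp_rw [tadpoleVertex_apply_toLp, cexp_valMinAbs_toLp_latticeMomentum, Finset.mul_sum]
  rw [Finset.sum_comm]
  refine Finset.sum_congr rfl fun q _ => Finset.sum_congr rfl fun y _ => ?_
  ring

/-- **The Hartree one-line value in closed form**: for the bare quartic (`β ≠ 0`),
`tadpoleCont β μ K Λ Λ' (hubbardInteraction U) P = −U/(β²L²)·Σ_{p₀} L⁻²·Σ_q ŝ_{p₀}(e_K(p_q))` — `P`-free (θ-blind), linear in `U`, and with the slice's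
prefactor `βL²` inside `ŝ` the combination `−(U/β)·(1/L²)Σ_q g` per kept frequency is volume-free (C4A-PLAN §22.4/22.5). -/
theorem tadpoleCont_hubbardInteraction {β : ℝ} (hβ : β ≠ 0) (U μ : ℝ) (K : TrigPolyC4v) (Λ Λ' : ℝ) (P : Fin 2 → ℝ) :
    tadpoleCont β μ K Λ Λ' (hubbardInteraction L M β U) P =
      (((-(U / (β ^ 2 * (L : ℝ) ^ 2))) : ℝ) : ℂ) * ∑ p₀ : MatsubaraIdx M, ((L : ℂ) ^ 2)⁻¹ * ∑ q : TorusSite 2 L,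
        sliceSymbolFnXi (β * (L : ℝ) ^ 2) 0 Λ Λ' (matsubaraFreq β M p₀) (DispersionFlow.frameLevel μ K (WithLp.toLp 2 (latticeMomentum L q))) := by
  rw [tadpoleCont_eq_sum_sliceSymbol_mul_tadpoleVertex, Finset.mul_sum]
  refine Finset.sum_congr rfl fun p₀ _ => ?_
  simp_rw [tadpoleVertex_hubbardInteraction hβ, Finset.mul_sum]
  refine Finset.sum_congr rfl fun q _ => ?_
  ring

/-- The same for the CT-dressed quartic `hubbardInteractionCT … K` (the quadratic counterterm does not enter the tadpole vertex). -/
theorem tadpoleCont_hubbardInteractionCT {β : ℝ} (hβ : β ≠ 0) (U μ : ℝ) (K K' : TrigPolyC4v) (Λ Λ' : ℝ) (P : Fin 2 → ℝ) :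
    tadpoleCont β μ K Λ Λ' (hubbardInteractionCT L M β U K') P =
      (((-(U / (β ^ 2 * (L : ℝ) ^ 2))) : ℝ) : ℂ) * ∑ p₀ : MatsubaraIdx M, ((L : ℂ) ^ 2)⁻¹ * ∑ q : TorusSite 2 L,
        sliceSymbolFnXi (β * (L : ℝ) ^ 2) 0 Λ Λ' (matsubaraFreq β M p₀) (DispersionFlow.frameLevel μ K (WithLp.toLp 2 (latticeMomentum L q))) := by
  rw [tadpoleCont_eq_sum_sliceSymbol_mul_tadpoleVertex, Finset.mul_sum]
  refine Finset.sum_congr rfl fun p₀ _ => ?_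
  simp_rw [tadpoleVertex_hubbardInteractionCT_eq_const hβ, Finset.mul_sum]
  refine Finset.sum_congr rfl fun q _ => ?_
  ring

end Summit.HubbardSuperconductivity.HubbardSuperconductivity.Theorems.C4a

end
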